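import Literature.AlgebraicGeometry.Frobenioids.ArchimedeanBasicPropertiesSchemaNegativeC
import Mathlib.CategoryTheory.Products.Basic
import Mathlib.CategoryTheory.SingleObj
import Mathlib.GroupTheory.SpecificGroups.Dihedral
import HarnessLib

/-!
# Frobenioids II, Theorem 3.6 at `C^Λ`: the `Λ`-indexed INSTANCE statements `Thm36i_istrTypes_C π pf rlf`,
# `Thm36iv_C π pf rlf`, `Thm36x_CA π pf rlf` over the completion INTERFACE (FACT-LIST F-0870, F-0877,
# F-0886) have REFUTABLE universal closures — they are facts AT THE CONSTRUCTED DATA only (part B: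
# product completion data)

Mochizuki, *The geometry of Frobenioids II: poly-Frobenioids*, Kyushu J. Math. **62** (2008) 401–460,
§3, Example 3.3 (ii) p. 28 ("`C^ℤ := C`; `C^ℚ := C^pf`; `C^ℝ := C^rlf`") and Theorem 3.6 (i) p. 36
("`(C^Λ)^istr` is of isotropic, base-trivial … type"), (iv) p. 37 (first sentence), (x) p. 38 ("If `D` is
slim, and `Λ ∈ {ℤ, ℝ}`, then `F` is also slim") [cite: MochizukiFrdII2008, Thm 3.6 pp.36-38].

Negative knowledge recorded next to `ArchimedeanTheoremsInstances.lean` (abc-iut-L1-t9), PROOF-ONLY (no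
definition, no instance), abc-iut cell seat abc-iut-f-008 (block F, float; class `preparatory`,
kernel_closedness `parametrised`).  Part A: `ArchimedeanTheoremsInstancesSchemaNegative.lean`.

As in part A, the rows quantify over the FREE completion interface `pf rlf : LambdaCompletion π`.  The
junk data used here are PRODUCT data: the category `C × J` with the structure functor `pr₁ ⋙ (C → F_Φ)`
and the functor `C → C × J`, `X ↦ (X, j₀)` — it lies over `D` on the nose (`over := rfl`) — for a
one-object or discrete second factor `J`:

* F-0870 (`Thm36i_istrTypes_C`, "`(C^Λ)^istr` base-trivial"): `J := Discrete Bool`; `(A, false)` and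
  `(A, true)` (with `A` the complex isotropic tip-`1` object) are isotropic and base-isomorphic, not
  isomorphic;
* F-0877 (`Thm36iv_C`, the action of `Aut(A)` on `O^×(A)` factors through `Aut_{D₀}(A₀)`): `J := ` the
  one-object category of the dihedral group `D₃`; `(id_A, r)` has the same image as the identity but
  conjugates the unit `(id_A, s) ∈ O^×((A, ⋆))` to `(id_A, r s r⁻¹) ≠ (id_A, s)`;
* F-0886 (`Thm36x_CA`, "`D` slim ⇒ `C^ℝ` slim"): over the SLIM one-object base `𝟙` (`π := ` the
  constant functor at `Spec ℝ`), `J := ` the one-object category of `ℤ`: the central element `1 ∈ ℤ`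
  gives a nontrivial natural automorphism of every `(C × J)_A → C × J`, so `C^ℝ := C × J` is not slim
  although `𝟙` is ([FrdI] §0; cf. Rmk. 1.13.1).

Theorems: `not_forall_thm36i_istrTypes_C`, `not_forall_thm36iv_C`, `not_forall_thm36x_CA` (¬ of the fully
quantified closures, universe level `0`), each from a named ¬-instance.

The INSTANCE forms at THE data (`Thm36Sub.pfCompletion`, `Thm36Sub.rlfCompletion`) are PROVED in the tree
and are what consumers bind: F-0870 ⟶ `ArchFrd.Thm36Sub.thm36i_istrTypes_C_holds` (+ `thm36i_istrTypes_C'`,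
`istrTypes_Q_holds`, `istrTypes_R_holds`); F-0877 ⟶ `ArchFrd.Thm36Sub.thm36iv_C_holds` (+
`thm36iv_factors_C`, `ivFactors_Q_holds`, `ivFactors_R_holds`); F-0886 ⟶ `ArchFrd.Thm36Sub.thm36x_CA_holds`
(`Thm36SubInstancesB.lean`; + `Slim.thm36x_C`, `thm36x_A`, `Thm36Sub.x_Q_holds`, `Thm36SubSlim.lean`).  So
each row is admissible ONLY at the constructed data (FACT-LIST class «universal-closure REFUTED; instance
form PROVED»).  Nothing here bears on the disputed [IUTchIII] Cor. 3.12 or takes a side; refuted-as-schema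
is a statement about OUR typing (the interface binders), not about the paper.
-/

namespace Literature.AlgebraicGeometry.Frobenioids

namespace ArchFrd

open CategoryTheory

namespace SchemaNegG

/-- For the product structure functor `pr₁ ⋙ (C → F_Φ)` on `C × Discrete Bool`, `(X, b)` is isotropic as
soon as `X` is (its isometric pre-steps are pairs of an isometric pre-step of `C` and an identity).
[cite: MochizukiFrdI2008, Def. 1.2 (iv) p.23] -/
theorem isIsotropic_prodBool (X : C (𝟭 D0)) (hX : PreFrobenioid.IsIsotropic (C.toElem (𝟭 D0)) X)
    (b : Discrete Bool) :
    PreFrobenioid.IsIsotropic (CategoryTheory.Prod.fst (C (𝟭 D0)) (Discrete Bool) ⋙ C.toElem (𝟭 D0))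
      (X, b) := by
  rintro ⟨Y, b'⟩ ⟨f, g⟩ hiso hpre
  have hf : IsIso f := hX f hiso hpre
  obtain ⟨b⟩ := b
  obtain ⟨b'⟩ := b'
  have hb := Discrete.eq_of_hom g
  dsimp only at hb
  subst hb
  rw [Subsingleton.elim g (𝟙 _)]
  exact (isIso_prod_iff _ _).mpr ⟨hf, inferInstance⟩

end SchemaNegG

open SchemaNegC SchemaNegG

/-! ### F-0870: `Thm36i_istrTypes_C` -/

/-- **F-0870, universal closure false:** at the product completion datum `pf := (C × Discrete Bool, Φ,
pr₁ ⋙ (C → F_Φ), X ↦ (X, false))` the `Λ = ℚ` conjunct of `Thm36i_istrTypes_C` asserts that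
`(C × Discrete Bool)^istr` is of base-trivial type; but `(A, true)` and `(A, false)` (with `A` the complex
isotropic tip-`1` object) are isotropic, base-isomorphic and not isomorphic.
[cite: MochizukiFrdII2008, Thm 3.6 (i) p.36] -/
theorem not_thm36i_istrTypes_C_prodBool :
    ¬ Thm36i_istrTypes_C (𝟭 D0)
        { cat := C (𝟭 D0) × Discrete Bool, monoid := Φ (𝟭 D0),
          str := CategoryTheory.Prod.fst _ _ ⋙ C.toElem (𝟭 D0),
          fromC := Functor.prod' (𝟭 _) ((Functor.const _).obj (Discrete.mk false)), over := rfl }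
        (LambdaCompletion.self (𝟭 D0)) := by
  intro h
  obtain ⟨-, hbt⟩ := h MonoidType.Q
  obtain ⟨e⟩ := hbt
    ⟨(unitObjOver (𝟭 D0) D0.complex, Discrete.mk true), isIsotropic_prodBool _ unitObjOver_isIsotropic _⟩
    ⟨(unitObjOver (𝟭 D0) D0.complex, Discrete.mk false), isIsotropic_prodBool _ unitObjOver_isIsotropic _⟩
    ⟨Iso.refl _⟩
  exact Bool.noConfusion (Discrete.eq_of_hom e.hom.hom.2)

/-- **F-0870 as a schema is not a fact:** the closure of `ArchFrd.Thm36i_istrTypes_C` over all bases and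
completion data (universe level `0`) is FALSE; at THE data it is `ArchFrd.Thm36Sub.thm36i_istrTypes_C_holds`.
[cite: MochizukiFrdII2008, Thm 3.6 (i) p.36] -/
theorem not_forall_thm36i_istrTypes_C :
    ¬ ∀ {D : Type} [Category.{0} D] (π : D ⥤ D0) (pf rlf : LambdaCompletion π),
        Thm36i_istrTypes_C π pf rlf :=
  fun h => not_thm36i_istrTypes_C_prodBool (h _ _ _)

/-! ### F-0877: `Thm36iv_C` -/

/-- **F-0877, universal closure false:** at the product completion datum with second factor the
one-object category of the dihedral group `D₃`, the `Λ = ℚ` conjunct of `Thm36iv_C` fails at `(A, ⋆)`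
(`A` the complex tip-`1` object): `(id_A, r)` and the identity have the same image in `Aut_{D₀}(A₀)` but
conjugation by `(id_A, r)` moves the unit `(id_A, s) ∈ O^×((A, ⋆))` since `r s r⁻¹ ≠ s`.
[cite: MochizukiFrdII2008, Thm 3.6 (iv) p.37] -/
theorem not_thm36iv_C_prodDihedral :
    ¬ Thm36iv_C (𝟭 D0)
        { cat := C (𝟭 D0) × SingleObj (DihedralGroup 3), monoid := Φ (𝟭 D0),
          str := CategoryTheory.Prod.fst _ _ ⋙ C.toElem (𝟭 D0),
          fromC := Functor.prod' (𝟭 _) ((Functor.const _).obj (SingleObj.star _)), over := rfl }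
        (LambdaCompletion.self (𝟭 D0)) := by
  intro h
  -- the automorphism `(id_A, r)` and the unit `(id_A, s)` of `(A, ⋆)`, `A` the complex tip-`1` object
  obtain ⟨-, hact⟩ := h MonoidType.Q (unitObjOver (𝟭 D0) D0.complex, SingleObj.star (DihedralGroup 3))
    ⟨(𝟙 _, DihedralGroup.r 1), (𝟙 _, DihedralGroup.r 2),
      Prod.hom_ext (Category.id_comp _) (by
        change DihedralGroup.r 2 * DihedralGroup.r 1 = (1 : DihedralGroup 3); decide),
      Prod.hom_ext (Category.id_comp _) (by
        change DihedralGroup.r 1 * DihedralGroup.r 2 = (1 : DihedralGroup 3); decide)⟩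
    (Iso.refl _) (Iso.ext rfl)
  have key := congrArg
    (fun i : ((unitObjOver (𝟭 D0) D0.complex, SingleObj.star (DihedralGroup 3)) :
        C (𝟭 D0) × SingleObj (DihedralGroup 3)) ≅
      (unitObjOver (𝟭 D0) D0.complex, SingleObj.star (DihedralGroup 3)) => i.hom.2) (hact
    ⟨(𝟙 _, DihedralGroup.sr 0), (𝟙 _, DihedralGroup.sr 0),
      Prod.hom_ext (Category.id_comp _) (by
        change DihedralGroup.sr 0 * DihedralGroup.sr 0 = (1 : DihedralGroup 3); decide),
      Prod.hom_ext (Category.id_comp _) (by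
        change DihedralGroup.sr 0 * DihedralGroup.sr 0 = (1 : DihedralGroup 3); decide)⟩
    ⟨PreFrobenioid.base_id (C.toElem (𝟭 D0)) _, PreFrobenioid.degFr_id (C.toElem (𝟭 D0)) _⟩)
  have key' : DihedralGroup.r 1 * (DihedralGroup.sr 0 * DihedralGroup.r 2) =
      (1 : DihedralGroup 3) * (DihedralGroup.sr 0 * 1) := key
  exact absurd key' (by decide)

/-- **F-0877 as a schema is not a fact:** the closure of `ArchFrd.Thm36iv_C` over all bases and completion
data (universe level `0`) is FALSE; at THE data it is `ArchFrd.Thm36Sub.thm36iv_C_holds` (and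
`thm36iv_factors_C` for `Λ = ℤ`). [cite: MochizukiFrdII2008, Thm 3.6 (iv) p.37] -/
theorem not_forall_thm36iv_C :
    ¬ ∀ {D : Type} [Category.{0} D] (π : D ⥤ D0) (pf rlf : LambdaCompletion π), Thm36iv_C π pf rlf :=
  fun h => not_thm36iv_C_prodDihedral (h _ _ _)

/-! ### F-0886: `Thm36x_CA` -/

/-- **F-0886, universal closure false:** over the slim one-object base `𝟙` (`π := ` the constant functor
at `Spec ℝ`), at the product completion datum `rlf := (C × B ℤ, Φ, pr₁ ⋙ (C → F_Φ), X ↦ (X, ⋆))` the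
`Λ = ℝ` conjunct of `Thm36x_CA` asserts that `C^ℝ := C × Bℤ` is slim; but the central element `1 ∈ ℤ`
is a nontrivial natural automorphism of `(C × Bℤ)_A → C × Bℤ`.
[cite: MochizukiFrdII2008, Thm 3.6 (x) p.38] -/
theorem not_thm36x_CA_prodInt :
    ¬ Thm36x_CA ((Functor.const (Discrete PUnit.{1})).obj D0.real)
        (LambdaCompletion.self _)
        { cat := C ((Functor.const (Discrete PUnit.{1})).obj D0.real) × SingleObj (Multiplicative ℤ),
          monoid := Φ _,
          str := CategoryTheory.Prod.fst _ _ ⋙ C.toElem _,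
          fromC := Functor.prod' (𝟭 _) ((Functor.const _).obj (SingleObj.star _)), over := rfl } := by
  intro h
  have hslimD : IsSlim (Discrete PUnit.{1}) :=
    ⟨fun A β => Iso.ext (NatTrans.ext (funext fun f => Subsingleton.elim _ _))⟩
  have hslim := h.1 MonoidType.R hslimD (by decide)
  -- the central element `1 ∈ ℤ` as a natural automorphism of the slice projection at `(A, ⋆)`
  have hβ := hslim.isRigid_forget
    (unitObjOver ((Functor.const (Discrete PUnit.{1})).obj D0.real) (Discrete.mk PUnit.unit),
      SingleObj.star (Multiplicative ℤ))
    (NatIso.ofComponents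
      (fun f => ⟨(𝟙 _, Multiplicative.ofAdd (1 : ℤ)), (𝟙 _, Multiplicative.ofAdd (-1 : ℤ)),
        Prod.hom_ext (Category.id_comp _) (by
          change Multiplicative.ofAdd (-1 : ℤ) * Multiplicative.ofAdd (1 : ℤ) = 1; decide),
        Prod.hom_ext (Category.id_comp _) (by
          change Multiplicative.ofAdd (1 : ℤ) * Multiplicative.ofAdd (-1 : ℤ) = 1; decide)⟩)
      (fun {f f'} g => Prod.hom_ext
        (by
          change g.left.1 ≫ 𝟙 _ = 𝟙 _ ≫ g.left.1
          rw [Category.comp_id, Category.id_comp])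
        (mul_comm (Multiplicative.ofAdd (1 : ℤ)) (show Multiplicative ℤ from g.left.2))))
  have hβ' := congrArg
    (fun γ : Over.forget (unitObjOver ((Functor.const (Discrete PUnit.{1})).obj D0.real)
          (Discrete.mk PUnit.unit), SingleObj.star (Multiplicative ℤ)) ≅
        Over.forget (unitObjOver ((Functor.const (Discrete PUnit.{1})).obj D0.real)
          (Discrete.mk PUnit.unit), SingleObj.star (Multiplicative ℤ)) =>
      (γ.hom.app (Over.mk (𝟙 (unitObjOver ((Functor.const (Discrete PUnit.{1})).obj D0.real)
        (Discrete.mk PUnit.unit), SingleObj.star (Multiplicative ℤ))))).2) hβ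
  have hβ'' : Multiplicative.ofAdd (1 : ℤ) = Multiplicative.ofAdd 0 := hβ'
  exact one_ne_zero (Multiplicative.ofAdd.injective hβ'')

/-- **F-0886 as a schema is not a fact:** the closure of `ArchFrd.Thm36x_CA` over all bases and completion
data (universe level `0`) is FALSE; at THE data it is `ArchFrd.Thm36Sub.thm36x_CA_holds` (and
`Slim.thm36x_C` / `thm36x_A` for `Λ = ℤ`). [cite: MochizukiFrdII2008, Thm 3.6 (x) p.38] -/
theorem not_forall_thm36x_CA :
    ¬ ∀ {D : Type} [Category.{0} D] (π : D ⥤ D0) (pf rlf : LambdaCompletion π), Thm36x_CA π pf rlf :=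
  fun h => not_thm36x_CA_prodInt (h _ _ _)

end ArchFrd

end Literature.AlgebraicGeometry.Frobenioids
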